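import Literature.Probability.RandomPlanarGeometry.SelfAvoidingWalk
import HarnessLib

/-!
# Lattice bound — support file for `stub_latticeBound`
(line `slit-continuous-restriction` of the crux `SAWLoopFugacityFlow.SimpleSubseqLimits`,
stmt-CriticalPhenomena-4982; registered skeleton
`Summits/CriticalPhenomena/SAWScalingLimit/Cruxes/SimpleSubseqLimits/Lines/slit_continuous_restriction.lean`)

Pure bookkeeping of the finite measure `SAW.law Ω δ u w` (the critical two-point SAW law
`P(γ) ∝ x_c^{|γ|}`, `SelfAvoidingWalk.lean`): if every GOOD first-entrance prefix `ω : u → t` into the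
closed ball `B̄(q, ρ)` (tip inside, earlier vertices outside) satisfies the conditional bound
`P[approachEvent ω (F ω) (ε ω)] ≤ θ · P[prefixEvent ω]`, then
`P[own first-entrance prefix is good ∧ a later vertex is ε-close to the assigned set] ≤ θ`.

Proof: the event is contained in the union, over the good first-entrance prefixes `(t, ω)` (a
countable index: a SAW is determined by its vertex list), of the approach events; the prefix events of
two distinct first-entrance prefixes are disjoint (two initial segments of one vertex list, both stopped
at the FIRST vertex in the ball, coincide), so the conditional bounds sum to `θ · P[⋃ prefixEvent] ≤ θ`.

* `prefixSAW γ k` — the first `k` steps of a SAW as a SAW to `γ_k` (support `= take (k + 1)`);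
* `sigma_mk_eq_of_support_eq` — SAWs from `u` (to any endpoint) are determined by their support;
* `stub_latticeBound : LatticeBound` — the registered stub.

No named facts. Sources: N. Madras, G. Slade, *The Self-Avoiding Walk* (1993), §1.2 (prefixes and
concatenation of SAWs).
-/

noncomputable section

open MeasureTheory Filter Topology Set Metric Function
open Literature.Probability.RandomPlanarGeometry Literature.Probability.RandomPlanarGeometry.SAW
open Literature.Probability.LatticeModels
open scoped ENNReal NNReal

namespace Summit.CriticalPhenomena.SAWScalingLimit.Theorems.SimpleSubseqLimits.SlitRestriction.Lattice

section Lattice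

variable {Ω : Set ℂ} {δ : ℝ} {u t v : Site 2}

/-- The **prefix event**: the walk from `u` to `v` starts with the vertices of the prefix walk `ω : u → t`.
[folklore] -/
def prefixEvent (ω : SAW.DomainSAW Ω δ u t) : Set (SAW.DomainSAW Ω δ u v) :=
  {γ | γ.walk.support.take (ω.length + 1) = ω.walk.support}

/-- The **approach event**: the walk has prefix `ω` and some LATER vertex (index `≥ |ω|`, the tip included)
comes `ε`-close to a point of the set `F`. [folklore] -/
def approachEvent (ω : SAW.DomainSAW Ω δ u t) (F : Set ℂ) (ε : ℝ) : Set (SAW.DomainSAW Ω δ u v) :=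
  {γ | γ.walk.support.take (ω.length + 1) = ω.walk.support ∧
    ∃ j : ℕ, ω.length ≤ j ∧ j ≤ γ.length ∧ ∃ z ∈ F, dist (meshPoint δ (γ.walk.getVert j)) z < ε}

end Lattice

/-- **LATTICE BOUND** (helper statement of the transfer; pure bookkeeping of the finite measure
`SAW.law`). If every first-entrance prefix `ω` into `B̄(q, ρ)` (tip vertex inside, earlier vertices
outside) whose vertex list is `Good` satisfies the conditional bound
`P[approachEvent ω (F ω) (ε ω)] ≤ θ · P[prefixEvent ω]` for an assignment `(F, ε)` depending only on
the vertex list, then the probability that the walk's own first-entrance prefix is good AND a later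
vertex comes `ε`-close to the assigned set is at most `θ`: the prefix events of distinct
first-entrance prefixes are disjoint and `P` has total mass `≤ 1`. The registered stub statement of
the line skeleton `Cruxes/SimpleSubseqLimits/Lines/slit_continuous_restriction.lean` (body verbatim);
a helper statement of this line, not a literature fact, hence untagged and declared here; proved below
(`stub_latticeBound`). -/
def LatticeBound : Prop :=
  ∀ (Ω : Set ℂ) (δ : ℝ) (u w : Site 2) (q : ℂ) (ρ θ : ℝ), 0 ≤ θ →
    ∀ (Good : List (Site 2) → Prop) (F : List (Site 2) → Set ℂ) (ε : List (Site 2) → ℝ),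
      (∀ (t : Site 2) (ω : SAW.DomainSAW Ω δ u t), meshPoint δ t ∈ closedBall q ρ →
          (∀ x ∈ ω.walk.support.dropLast, meshPoint δ x ∉ closedBall q ρ) →
          Good ω.walk.support →
          SAW.law Ω δ u w (approachEvent (v := w) ω (F ω.walk.support) (ε ω.walk.support)) ≤
            ENNReal.ofReal θ * SAW.law Ω δ u w (prefixEvent (v := w) ω)) →
      SAW.law Ω δ u w {γ | ∃ k : ℕ, k ≤ γ.length ∧
          meshPoint δ (γ.walk.getVert k) ∈ closedBall q ρ ∧
          (∀ i : ℕ, i < k → meshPoint δ (γ.walk.getVert i) ∉ closedBall q ρ) ∧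
          Good (γ.walk.support.take (k + 1)) ∧
          ∃ j : ℕ, k ≤ j ∧ j ≤ γ.length ∧ ∃ z ∈ F (γ.walk.support.take (k + 1)),
            dist (meshPoint δ (γ.walk.getVert j)) z < ε (γ.walk.support.take (k + 1))} ≤
        ENNReal.ofReal θ

/-! ### List and walk bookkeeping -/

/-- Dropping the last entry of the first `k + 1` entries leaves the first `k` entries (when the list
has at least `k + 1` entries). [folklore] -/
theorem dropLast_take_succ {α : Type*} (l : List α) {k : ℕ} (hk : k + 1 ≤ l.length) :
    (l.take (k + 1)).dropLast = l.take k := by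
  rw [List.dropLast_eq_take, List.length_take, Nat.min_eq_left hk, Nat.add_sub_cancel,
    List.take_take, Nat.min_eq_left (Nat.le_succ k)]

section Walks

variable {Ω : Set ℂ} {δ : ℝ} {u t w : Site 2}

/-- The total mass of the critical SAW law is at most `1` (it is `Z⁻¹ · Z`). [folklore] -/
theorem law_univ_le_one : SAW.law Ω δ u w univ ≤ 1 := by
  rw [SAW.law, Measure.smul_apply, smul_eq_mul]
  exact ENNReal.inv_mul_le_one _

-- adapted from Literature/Barriers/CriticalPhenomena/SupercriticalSAWSpaceFillingAnnealed.lean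
-- (`instCountableDomainSAW`)
/-- The space of SAWs of `Ω_δ` between two sites is countable (a walk of a simple graph is
determined by its support, a list of sites). [folklore] -/
theorem countable_domainSAW : Countable (SAW.DomainSAW Ω δ u w) := by
  have hinj : Function.Injective fun γ : SAW.DomainSAW Ω δ u w => γ.walk.support := by
    intro γ γ' h
    have hw : γ.walk = γ'.walk := SimpleGraph.Walk.support_injective h
    cases γ; cases γ'; cases hw; rfl
  exact hinj.countable

/-- SAWs from `u`, with unspecified endpoint, are determined by their support. [folklore] -/
theorem sigma_mk_eq_of_support_eq {t₁ t₂ : Site 2} (ω₁ : SAW.DomainSAW Ω δ u t₁)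
    (ω₂ : SAW.DomainSAW Ω δ u t₂) (h : ω₁.walk.support = ω₂.walk.support) :
    (⟨t₁, ω₁⟩ : Σ t : Site 2, SAW.DomainSAW Ω δ u t) = ⟨t₂, ω₂⟩ := by
  have ht : t₁ = t₂ := by
    have h1 := congrArg List.getLast? h
    rw [List.getLast?_eq_getLast_of_ne_nil ω₁.walk.support_ne_nil,
      List.getLast?_eq_getLast_of_ne_nil ω₂.walk.support_ne_nil, SimpleGraph.Walk.getLast_support,
      SimpleGraph.Walk.getLast_support, Option.some_inj] at h1
    exact h1
  subst ht
  have hw : ω₁.walk = ω₂.walk := SimpleGraph.Walk.support_injective h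
  cases ω₁; cases ω₂; cases hw; rfl

-- adapted from Summits/CriticalPhenomena/SAWScalingLimit/Theorems/
-- SAWLoopFugacityFlowSimpleSubseqLimitsStubDomainMarkovWalks.lean (`getVert_eq_of_take_eq`)
/-- A walk whose first `|ω| + 1` vertices are the vertices of `ω : u → t` is at least as long as
`ω`, passes through `t` at time `|ω|`, and its vertices before time `|ω|` are the non-final
vertices of `ω`. [folklore] -/
theorem prefix_facts (ω : SAW.DomainSAW Ω δ u t) (γ : SAW.DomainSAW Ω δ u w)
    (h : γ.walk.support.take (ω.length + 1) = ω.walk.support) :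
    ω.length ≤ γ.length ∧ γ.walk.getVert ω.length = t ∧
      ∀ i : ℕ, i < ω.length → γ.walk.getVert i ∈ ω.walk.support.dropLast := by
  have hlen : ω.length ≤ γ.length := by
    have h' := congrArg List.length h
    rw [List.length_take, SimpleGraph.Walk.length_support, SimpleGraph.Walk.length_support] at h'
    change min (ω.length + 1) (γ.length + 1) = ω.length + 1 at h'
    omega
  refine ⟨hlen, ?_, fun i hi => ?_⟩
  · have h1 := SimpleGraph.Walk.getVert_eq_support_getElem? γ.walk hlen
    have h2 := SimpleGraph.Walk.getVert_eq_support_getElem? ω.walk le_rfl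
    rw [SimpleGraph.Walk.getVert_length, ← h, List.getElem?_take] at h2
    change some t = if ω.length < ω.length + 1 then γ.walk.support[ω.length]? else none at h2
    rw [if_pos (Nat.lt_succ_self _), ← h1] at h2
    exact (Option.some_injective _ h2).symm
  · have hk : ω.length + 1 ≤ γ.walk.support.length := by
      rw [SimpleGraph.Walk.length_support]; exact Nat.succ_le_succ hlen
    rw [← h, dropLast_take_succ _ hk, List.mem_take_iff_getElem]
    refine ⟨i, ?_, SimpleGraph.Walk.support_getElem_eq_getVert _ _⟩
    rw [SimpleGraph.Walk.length_support]
    exact lt_min hi (Nat.lt_succ_of_le ((le_of_lt hi).trans hlen))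

/-- The first `k` steps of a SAW, a SAW from `u` to the `k`-th vertex. [folklore] -/
def prefixSAW (γ : SAW.DomainSAW Ω δ u w) (k : ℕ) : SAW.DomainSAW Ω δ u (γ.walk.getVert k) :=
  ⟨γ.walk.take k, by
    rw [SimpleGraph.Walk.isPath_def, SimpleGraph.Walk.support_take]
    exact ((SimpleGraph.Walk.isPath_def _).1 γ.isPath).sublist (List.take_sublist _ _)⟩

/-- The vertices of the prefix SAW are the first `k + 1` vertices. [folklore] -/
theorem support_prefixSAW (γ : SAW.DomainSAW Ω δ u w) (k : ℕ) :
    (prefixSAW γ k).walk.support = γ.walk.support.take (k + 1) :=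
  SimpleGraph.Walk.support_take _ _

/-- The prefix SAW has length `k` (for `k ≤ |γ|`). [folklore] -/
theorem length_prefixSAW (γ : SAW.DomainSAW Ω δ u w) {k : ℕ} (hk : k ≤ γ.length) :
    (prefixSAW γ k).length = k := by
  change (γ.walk.take k).length = k
  rw [SimpleGraph.Walk.take_length]
  exact Nat.min_eq_left hk

/-- The non-final vertices of the prefix SAW are vertices of `γ` at times `< k`. [folklore] -/
theorem exists_lt_of_mem_dropLast (γ : SAW.DomainSAW Ω δ u w) {k : ℕ} (hk : k ≤ γ.length)
    {x : Site 2} (hx : x ∈ (prefixSAW γ k).walk.support.dropLast) :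
    ∃ i : ℕ, i < k ∧ x = γ.walk.getVert i := by
  have hk' : k + 1 ≤ γ.walk.support.length := by
    rw [SimpleGraph.Walk.length_support]; exact Nat.succ_le_succ hk
  rw [support_prefixSAW, dropLast_take_succ _ hk', List.mem_take_iff_getElem] at hx
  obtain ⟨i, hi, rfl⟩ := hx
  exact ⟨i, (lt_min_iff.1 hi).1, SimpleGraph.Walk.support_getElem_eq_getVert _ _⟩

end Walks

/-! ### The stub -/

/-- **stub 2a — LATTICE BOUND** (helper of the transfer): the conditional bounds over the GOOD
first-entrance prefixes sum, over the pairwise disjoint prefix events, to a bound `θ · P[univ] ≤ θ`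
for the event "the own first-entrance prefix is good and a later vertex approaches the assigned
set". [folklore] -/
theorem stub_latticeBound : LatticeBound := by
  intro Ω δ u w q ρ θ _ Good F ε hcond
  -- the countable index of prefixes `(t, ω : u → t)` and the good first-entrance ones
  haveI : ∀ t : Site 2, Countable (SAW.DomainSAW Ω δ u t) := fun _ => countable_domainSAW
  set S : Set (Σ t : Site 2, SAW.DomainSAW Ω δ u t) := {i | meshPoint δ i.1 ∈ closedBall q ρ ∧
    (∀ x ∈ i.2.walk.support.dropLast, meshPoint δ x ∉ closedBall q ρ) ∧ Good i.2.walk.support}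
  have hmeas : ∀ s : Set (SAW.DomainSAW Ω δ u w), MeasurableSet s := fun _ =>
    MeasurableSpace.measurableSet_top
  -- the prefix events of distinct good first-entrance prefixes are disjoint
  have hdisj : Pairwise (Disjoint on fun i : S => prefixEvent (v := w) i.1.2) := by
    intro i j hne
    refine Set.disjoint_left.2 fun γ h₁ h₂ => hne (Subtype.ext ?_)
    obtain ⟨⟨t₁, ω₁⟩, hin₁, hout₁, _hg₁⟩ := i
    obtain ⟨⟨t₂, ω₂⟩, hin₂, hout₂, _hg₂⟩ := j
    dsimp only at hin₁ hout₁ hin₂ hout₂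
    simp only [prefixEvent, Set.mem_setOf_eq] at h₁ h₂
    obtain ⟨_, ht₁, hlt₁⟩ := prefix_facts ω₁ γ h₁
    obtain ⟨_, ht₂, hlt₂⟩ := prefix_facts ω₂ γ h₂
    have hlen : ω₁.length = ω₂.length := by
      rcases lt_trichotomy ω₁.length ω₂.length with hlt | heq | hgt
      · exact absurd (by rw [ht₁]; exact hin₁) (hout₂ _ (hlt₂ _ hlt))
      · exact heq
      · exact absurd (by rw [ht₂]; exact hin₂) (hout₁ _ (hlt₁ _ hgt))
    exact sigma_mk_eq_of_support_eq ω₁ ω₂ (by rw [← h₁, ← h₂, hlen])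
  refine le_trans (measure_mono (t := ⋃ i : S,
    approachEvent (v := w) i.1.2 (F i.1.2.walk.support) (ε i.1.2.walk.support)) ?_) ?_
  · -- the event is covered by the approach events of the good first-entrance prefixes
    rintro γ ⟨k, hk, hin, hout, hgood, j, hkj, hj, z, hz, hdist⟩
    rw [Set.mem_iUnion]
    have hsupp := support_prefixSAW γ k
    have hlen := length_prefixSAW γ hk
    refine ⟨⟨⟨γ.walk.getVert k, prefixSAW γ k⟩, hin, fun x hx => ?_, ?_⟩, ?_⟩
    · obtain ⟨i, hi, rfl⟩ := exists_lt_of_mem_dropLast γ hk hx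
      exact hout i hi
    · show Good (prefixSAW γ k).walk.support
      rw [hsupp]; exact hgood
    · show γ ∈ approachEvent (v := w) (prefixSAW γ k) (F (prefixSAW γ k).walk.support)
        (ε (prefixSAW γ k).walk.support)
      rw [approachEvent, Set.mem_setOf_eq, hsupp, hlen]
      exact ⟨rfl, j, hkj, hj, z, hz, hdist⟩
  · calc SAW.law Ω δ u w (⋃ i : S,
            approachEvent (v := w) i.1.2 (F i.1.2.walk.support) (ε i.1.2.walk.support))
          ≤ ∑' i : S, SAW.law Ω δ u w
            (approachEvent (v := w) i.1.2 (F i.1.2.walk.support) (ε i.1.2.walk.support)) :=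
          measure_iUnion_le _
      _ ≤ ∑' i : S, ENNReal.ofReal θ * SAW.law Ω δ u w (prefixEvent (v := w) i.1.2) :=
          ENNReal.tsum_le_tsum fun i => hcond i.1.1 i.1.2 i.2.1 i.2.2.1 i.2.2.2
      _ = ENNReal.ofReal θ * SAW.law Ω δ u w (⋃ i : S, prefixEvent (v := w) i.1.2) := by
          rw [ENNReal.tsum_mul_left, measure_iUnion hdisj fun _ => hmeas _]
      _ ≤ ENNReal.ofReal θ * 1 := by
          gcongr
          exact (measure_mono (subset_univ _)).trans law_univ_le_one
      _ = ENNReal.ofReal θ := mul_one _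

end Summit.CriticalPhenomena.SAWScalingLimit.Theorems.SimpleSubseqLimits.SlitRestriction.Lattice

end
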